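import Summits.HodgeConjecture.HodgeConjecture.Theses.PadicSemiregularLift
import Summits.HodgeConjecture.HodgeConjecture.Theorems.HodgeFermatVarieties.Negative.DegreeZeroVacuous
import Literature.AlgebraicGeometry.Motives.VarietiesUnitProofs
import Literature.AlgebraicGeometry.Motives.VarietiesDimensionProofs
import Literature.AlgebraicGeometry.Motives.VarietiesProjectiveSpaceProofs
import Literature.NumberTheory.Transcendental.AnalytificationProjProofs

/-!
# `HodgeBeyondAnchors` is false without `IsSmoothProjective` (negative-side lemmas)

Refuter lane `Theorems/HodgeBeyondAnchors/Negative/` for the crux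
`PadicSemiregularLift.HodgeBeyondAnchors` (stmt-HodgeConjecture-14054): helper lemmas only, no
Theses declaration is asserted. Source: the disprover's work file
`Cruxes/HodgeBeyondAnchors/Disproof.lean` (refuter-cdisprove-stmt-HodgeConjecture-14054-0, cycle 1).

The crux is the Hodge conjecture off the two anchor classes and is summit-complete
(`Theorems/PadicSemiregularLiftHodgeBeyondAnchorsEquivalence.lean`), so no honest refutation short
of a counterexample to the Hodge conjecture exists. What CAN be certified is which hypothesis is
load-bearing FOR THE TYPING. The conclusion `HodgeTheory.HodgeConjectureFor n X` carries the
anti-vacuity conjunct `Nonempty (HodgeModel n X)`: a Hodge model is a complex manifold charted on a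
model space of `finrank = n` and homeomorphic to `X(ℂ)`, so the index `n` must be the dimension
of `X`. Witness: the point `Spec ℂ = 𝟙_ (SchemeOver ℂ)` — a genuine smooth projective variety of
dimension `0` (`Motives.isSmoothProjective_unit_holds`) — read with the index `n = 1`:

* `isEmpty_hodgeModel_unit` — no Hodge model of the point in dimension `d ≥ 1` (the chart image
  of its unique point would be an open singleton of a non-trivial normed space);
* `not_hodgeConjectureFor_unit` — hence `¬ HodgeConjectureFor d (Spec ℂ)` for `d ≥ 1`;
* `not_forall_nonempty_hodgeModel` — tightness of the named fact `HodgeTheory.nonempty_hodgeModel`: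
  its hypothesis `IsSmoothProjective n X` cannot be weakened to "smooth projective of some
  dimension";
* `abelianVariety_X_ne_unit`, `not_isFermatVariety_succ_unit` — the point satisfies both anchor
  exclusions in every positive dimension (`schemeDim = 0`; a closed immersion from the one-point
  scheme cannot have range `V₊(x₀ᵐ + ⋯ + x_{d+2}ᵐ)`, which is empty for `m = 0`
  (`HodgeFermatVarietiesNegative.isEmpty_of_isFermatVariety_zero`) and contains the two points
  `[1 : ζ : 0 : ⋯] ≠ [1 : 0 : ζ : 0 : ⋯]`, `ζᵐ = -1`, for `m ≥ 1`);
* `hodgeBeyondAnchors_false_without_isSmoothProjective` — the crux with `IsSmoothProjective n X`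
  dropped is FALSE;
* `hodgeBeyondAnchors_false_with_decoupled_index` — sharper: the crux with the dimension index of
  the hypothesis decoupled from that of the conclusion is FALSE, even over genuine smooth
  projective varieties; so any proof must use `IsSmoothProjective n X` at least through
  `schemeDim X = n` (`Motives.schemeDim_eq_holds`), cf. `not_isSmoothProjective_one_unit`.

These refutations bite only the anti-vacuity conjunct, never the cycle clause: they say nothing
about Hodge classes (recorded so that no prover or planner mistakes the index bookkeeping for
content, and no restatement of the item drops or decouples the index).

References: J.-P. Serre, GAGA, Ann. Inst. Fourier 6 (1956) §2 (analytification, dimension of the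
model space); R. Hartshorne, *Algebraic Geometry* (1977), II Ex. 2.14 (points of `Proj`), II §4.
-/

set_option linter.dupNamespace false

noncomputable section

open CategoryTheory AlgebraicGeometry MonoidalCategory CartesianMonoidalCategory Topology
open scoped Manifold
open Literature.AlgebraicGeometry.Motives Literature.AlgebraicGeometry.HodgeTheory
open Literature.NumberTheory.Transcendental

namespace Summit.HodgeConjecture.HodgeConjecture.Theorems.HodgeBeyondAnchors.Negative

open Summit.HodgeConjecture.HodgeConjecture.Theses.PadicSemiregularLift

/-! The witness is the point `Spec ℂ`, written throughout as the monoidal unit `𝟙_ (SchemeOver ℂ)`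
(no definition or notation is introduced). -/

/-- `Spec ℂ` has exactly one complex point (it is terminal in `SchemeOver ℂ`). [folklore] -/
theorem subsingleton_complexPoints_unit : Subsingleton (ComplexPoints (𝟙_ (SchemeOver ℂ))) :=
  inferInstanceAs (Subsingleton (specOver ℂ ℂ ⟶ 𝟙_ (SchemeOver ℂ)))

/-- `Spec ℂ` has a complex point. [folklore] -/
theorem nonempty_complexPoints_unit : Nonempty (ComplexPoints (𝟙_ (SchemeOver ℂ))) := ⟨toUnit _⟩

/-- **No Hodge model of the point in positive dimension.** A Hodge model of `Spec ℂ` read in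
dimension `d` is a complex manifold charted on a model space `E` with `finrank ℂ E = d`,
homeomorphic to the one-point space `(Spec ℂ)(ℂ)`; for `d ≥ 1` the chart image of its point would
be an open singleton of the non-trivial normed space `E`. [folklore] -/
theorem isEmpty_hodgeModel_unit {d : ℕ} (hd : 1 ≤ d) : IsEmpty (HodgeModel d (𝟙_ (SchemeOver ℂ))) := by
  refine ⟨fun A ↦ ?_⟩
  have hφ := A.isAnalytification.isHomeomorph
  haveI := subsingleton_complexPoints_unit
  haveI : Subsingleton A.carrier := hφ.injective.subsingleton
  obtain ⟨m, -⟩ := hφ.surjective (toUnit _)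
  haveI : Nontrivial A.model :=
    Module.nontrivial_of_finrank_pos (R := ℂ) (by rw [A.isAnalytification.finrank_eq]; omega)
  haveI := Module.punctured_nhds_neBot ℂ A.model
  set e := chartAt A.model m
  have hopen : IsOpen ({m} : Set A.carrier) := by
    have : ({m} : Set A.carrier) = Set.univ := Set.eq_univ_of_forall fun x ↦ Subsingleton.elim x m
    rw [this]; exact isOpen_univ
  have himg : IsOpen (e '' {m}) :=
    e.isOpen_image_of_subset_source hopen (Set.singleton_subset_iff.2 (mem_chart_source _ m))
  rw [Set.image_singleton, isOpen_singleton_iff_punctured_nhds] at himg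
  exact (inferInstance : Filter.NeBot (𝓝[≠] (e m))).ne himg

/-- Hence the Hodge conjecture "for `Spec ℂ` in dimension `d ≥ 1`" is FALSE as typed: its
anti-vacuity conjunct `Nonempty (HodgeModel d _)` fails. [folklore] -/
theorem not_hodgeConjectureFor_unit {d : ℕ} (hd : 1 ≤ d) :
    ¬ HodgeConjectureFor d (𝟙_ (SchemeOver ℂ)) :=
  fun h ↦ (isEmpty_hodgeModel_unit hd).false h.1.some

/-- Tightness of the tree's named fact `HodgeTheory.nonempty_hodgeModel`
(`IsSmoothProjective n X → Nonempty (HodgeModel n X)`): its hypothesis cannot be dropped, not even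
weakened to "`X` smooth projective of SOME dimension". [folklore] -/
theorem not_forall_nonempty_hodgeModel :
    ¬ ∀ (n : ℕ) (X : SchemeOver ℂ), IsSmoothProjective 0 X → Nonempty (HodgeModel n X) :=
  fun h ↦ (isEmpty_hodgeModel_unit le_rfl).false
    (h 1 (𝟙_ (SchemeOver ℂ)) (isSmoothProjective_unit_holds ℂ)).some

/-- `Spec ℂ` has dimension `0`. [folklore] -/
theorem schemeDim_unit : schemeDim (𝟙_ (SchemeOver ℂ)).left = 0 :=
  schemeDim_eq_holds (isSmoothProjective_unit_holds ℂ)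

/-- `Spec ℂ` is not the underlying scheme of an abelian variety of positive dimension.
[folklore] -/
theorem abelianVariety_X_ne_unit {d : ℕ} (hd : 1 ≤ d) (A : AbelianVariety ℂ) (hA : A.dim = d) :
    A.X ≠ 𝟙_ (SchemeOver ℂ) := by
  intro h
  have h0 : A.dim = 0 := by
    show schemeDim A.X.left = 0
    rw [h]; exact schemeDim_unit
  omega

/-- The underlying space of `Spec ℂ` is one point. [folklore] -/
theorem subsingleton_unit_left : Subsingleton ↥(𝟙_ (SchemeOver ℂ)).left :=
  inferInstanceAs (Subsingleton (PrimeSpectrum ℂ))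

/-- The underlying space of `Spec ℂ` is non-empty. [folklore] -/
theorem nonempty_unit_left : Nonempty ↥(𝟙_ (SchemeOver ℂ)).left :=
  inferInstanceAs (Nonempty (PrimeSpectrum ℂ))

/-- `F(v) = Σ vᵢᵐ` for the Fermat form `F = Σ xᵢᵐ`. [folklore] -/
theorem eval_fermatPolynomial (n m : ℕ) (v : Fin (n + 2) → ℂ) :
    MvPolynomial.eval v (fermatPolynomial ℂ n m) = ∑ i, v i ^ m := by
  simp [fermatPolynomial]

/-- **`Spec ℂ` is not a Fermat variety of positive dimension.** `IsFermatVariety (d + 1) m (Spec ℂ)`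
would give a closed immersion `ι : Spec ℂ → ℙᵈ⁺²` with one-point range equal to
`V₊(x₀ᵐ + ⋯ + x_{d+2}ᵐ)`; for `m = 0` that zero locus is empty
(`HodgeFermatVarietiesNegative.isEmpty_of_isFermatVariety_zero`), for `m ≥ 1` it contains the two
distinct points `[1 : ζ : 0 : ⋯]`, `[1 : 0 : ζ : 0 : ⋯]`, `ζᵐ = -1`.
[cite: Hartshorne1977, II Ex. 2.14] -/
theorem not_isFermatVariety_succ_unit (d m : ℕ) : ¬ IsFermatVariety (d + 1) m (𝟙_ (SchemeOver ℂ)) := by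
  rcases Nat.eq_zero_or_pos m with rfl | hm
  · exact fun hF ↦ (HodgeFermatVarietiesNegative.isEmpty_of_isFermatVariety_zero hF).false
      nonempty_unit_left.some
  letI := MvPolynomial.gradedAlgebra (σ := Fin (d + 1 + 1 + 1)) (R := ℂ)
  rintro ⟨_, ι, _, hrange⟩
  obtain ⟨ζ, hζ⟩ : ∃ ζ : ℂ, ζ ^ m = -1 := IsAlgClosed.exists_pow_nat_eq (-1) hm
  have hζ0 : ζ ≠ 0 := by
    rintro rfl
    rw [zero_pow hm.ne'] at hζ
    exact one_ne_zero (neg_eq_zero.1 hζ.symm)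
  have hF : fermatPolynomial ℂ (d + 1) m ∈
      MvPolynomial.homogeneousSubmodule (Fin (d + 1 + 1 + 1)) ℂ m :=
    (MvPolynomial.mem_homogeneousSubmodule m _).2 (isHomogeneous_fermatPolynomial (d + 1) m)
  -- membership of `[v]` in the range, from `F(v) = 0`
  have hmem : ∀ (v : Fin (d + 1 + 1 + 1) → ℂ) (hv : v ≠ 0),
      MvPolynomial.eval v (fermatPolynomial ℂ (d + 1) m) = 0 →
      (projPoint (d + 1 + 1) (Projectivization.mk ℂ v hv)).pt ∈ Set.range ι.left.base := by
    intro v hv hv0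
    rw [hrange]
    refine (ProjectiveSpectrum.mem_zeroLocus _ _ _).2 (Set.singleton_subset_iff.2 ?_)
    by_contra hnot
    exact ((pt_projPoint_mk_mem_basicOpen_iff (d + 1 + 1) v hv hm hF).1
      ((Proj.mem_basicOpen _ _ _).2 hnot)) hv0
  -- the two vectors, at the native type of the Fermat form
  have h1 : (Matrix.vecCons 1 (Matrix.vecCons ζ 0) : Fin (d + 1 + 2) → ℂ) ≠ 0 :=
    fun h ↦ by simpa using congr_fun h 0
  have h2 : (Matrix.vecCons 1 (Matrix.vecCons 0 (Matrix.vecCons ζ 0)) : Fin (d + 1 + 2) → ℂ) ≠ 0 :=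
    fun h ↦ by simpa using congr_fun h 0
  have hz1 : MvPolynomial.eval (Matrix.vecCons 1 (Matrix.vecCons ζ 0) : Fin (d + 1 + 2) → ℂ)
      (fermatPolynomial ℂ (d + 1) m) = 0 := by
    rw [eval_fermatPolynomial, Fin.sum_univ_succ, Fin.sum_univ_succ]
    simp [hζ, zero_pow hm.ne']
  have hz2 : MvPolynomial.eval
      (Matrix.vecCons 1 (Matrix.vecCons 0 (Matrix.vecCons ζ 0)) : Fin (d + 1 + 2) → ℂ)
      (fermatPolynomial ℂ (d + 1) m) = 0 := by
    rw [eval_fermatPolynomial, Fin.sum_univ_succ, Fin.sum_univ_succ, Fin.sum_univ_succ]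
    simp [hζ, zero_pow hm.ne']
  obtain ⟨a, ha⟩ := hmem _ h1 hz1
  obtain ⟨b, hb⟩ := hmem _ h2 hz2
  obtain rfl : a = b := subsingleton_unit_left.elim a b
  have hpt := ha.symm.trans hb
  haveI := (isSmoothProjective_projectiveSpace_holds ℂ (d + 1 + 1)).smoothOfRelativeDimension
  haveI : Smooth (projectiveSpace (d + 1 + 1) ℂ).hom :=
    SmoothOfRelativeDimension.smooth (d + 1 + 1) _
  have heq := projPoint_injective (d + 1 + 1)
    (Literature.AlgebraicGeometry.Motives.ComplexPoints.ext_of_pt_eq hpt)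
  rw [Projectivization.mk_eq_mk_iff] at heq
  obtain ⟨u, hu⟩ := heq
  have hu1 := congr_fun hu 1
  simp only [Pi.smul_apply, Matrix.cons_val_one, Matrix.cons_val_zero, smul_zero] at hu1
  exact hζ0 (by simpa using hu1.symm)

/-- **`IsSmoothProjective` is load-bearing (for the typing).** Dropping it from the crux gives a
FALSE statement: the point read in dimension `1` satisfies both anchor exclusions and fails
`HodgeConjectureFor 1` through the anti-vacuity conjunct. Any proof of the crux must use
`IsSmoothProjective n X` — at least its consequence `schemeDim X = n`. [folklore] -/
theorem hodgeBeyondAnchors_false_without_isSmoothProjective :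
    ¬ ∀ ⦃n : ℕ⦄ ⦃X : SchemeOver ℂ⦄,
      (∀ A : AbelianVariety ℂ, A.dim = n → A.X ≠ X) →
      (∀ m : ℕ, ¬ IsFermatVariety n m X) → HodgeConjectureFor n X :=
  fun h ↦ not_hodgeConjectureFor_unit le_rfl
    (h (abelianVariety_X_ne_unit le_rfl) (not_isFermatVariety_succ_unit 0))

/-- **The conclusion's index is load-bearing even over genuine smooth projective varieties.**
Decoupling the dimension index of the hypothesis from that of the conclusion gives a FALSE
statement (witness: the smooth projective `0`-fold `Spec ℂ`, conclusion read with `n = 1`).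
[folklore] -/
theorem hodgeBeyondAnchors_false_with_decoupled_index :
    ¬ ∀ ⦃n n' : ℕ⦄ ⦃X : SchemeOver ℂ⦄, IsSmoothProjective n' X →
      (∀ A : AbelianVariety ℂ, A.dim = n → A.X ≠ X) →
      (∀ m : ℕ, ¬ IsFermatVariety n m X) → HodgeConjectureFor n X :=
  fun h ↦ not_hodgeConjectureFor_unit le_rfl
    (h (isSmoothProjective_unit_holds ℂ) (abelianVariety_X_ne_unit le_rfl)
      (not_isFermatVariety_succ_unit 0))

/-- Consistency check in the other direction: WITH the hypothesis the index is the dimension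
(`schemeDim_eq_holds`), so the witness is excluded exactly by `IsSmoothProjective 1 (Spec ℂ)` being
false. [folklore] -/
theorem not_isSmoothProjective_one_unit : ¬ IsSmoothProjective 1 (𝟙_ (SchemeOver ℂ)) := fun h ↦ by
  have h1 : schemeDim (𝟙_ (SchemeOver ℂ)).left = 1 := schemeDim_eq_holds h
  rw [schemeDim_unit] at h1
  exact zero_ne_one h1

end Summit.HodgeConjecture.HodgeConjecture.Theorems.HodgeBeyondAnchors.Negative

end
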